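import Summits.QuantumFields.YangMills.Theses.OneCertifiedCube

/-!
# Route `OneCertifiedCube`, crux `CrossoverCertificate` (stmt-QuantumFields-16125): the TV influence functional

Route-posited objects (D-0016 `<Route><Crux>Defs` file) shared by the registered stubs of the skeleton
`Cruxes/CrossoverCertificate/Lines/birth.lean` (line `registered`, lead `prover-line-stmt-QuantumFields-16125-0`)
and by the crux file that composes them.  The two definitions are VERBATIM those of the registered skeleton (same
namespace `Summit.QuantumFields.YangMills.Cruxes.CrossoverCertificate.Birth`, so the registered stub signatures are
unchanged):

* `influenceSet ρ β b n` — the set of all total-variation boundary influences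
  `|∫ f dγ_A(·|η) − ∫ f dγ_A(·|η′)|` on the central cell, over `[b,2b]`-frames `w` of `ℤ⁴`, cell unions
  `A = ⋃_{y ∈ Y} cell_w(y)` with `0 ∈ Y ⊆ [-2n,2n]⁴`, boundary conditions `η, η′` agreeing on the cube of
  `(4n+1)⁴` cells and `[0,1]`-valued measurable cylinder functions `f` of the central cell — VERBATIM the binders
  of the finite-size condition of `Summit.QuantumFields.YangMills.Theses.OneCertifiedCube.CrossoverCertificate`
  (`γ = ymSpecification ρ β`, the Wilson specification of `Literature/…/LatticeGaugeDLR.lean`);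
* `influence ρ β b n := sSup (influenceSet ρ β b n)` — the worst-case influence `Θ(ρ, β, b, n) ∈ [0, 2]`.

Elementary API (nothing about Yang–Mills is asserted): every influence is `≤ 2` (the kernels are tilted, hence
zero-or-probability, measures and `f ∈ [0,1]`), `0 ∈ influenceSet` (frame `w i j = b·j`, `Y = {0}`, `η = η′ = 1`,
`f = 0`), so `0 ≤ Θ ≤ 2`; and the BRIDGE `finiteSize_iff_influence_le`: the crux's finite-size condition at
`(ρ, β, b, n, ε)` is literally `Θ(ρ, β, b, n) ≤ ε` (`le_csSup` / `csSup_le`), whence `crossoverCertificate_iff`: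
the crux reads `∃ ℓ > 0, ∃ n ≥ 1, ∃ ε ≥ 0, ε·M(n) < 1 ∧ ∀ᶠ k, Θ(r.ρ, β_k, ⌈ℓ/a_k⌉₊, n) ≤ ε` (`Iff` by rewriting
under the binders).  This is the compact restatement the route header asks for ("DEFINITION REQUESTS … a later
definition item … would let a tenure pass restate all three compactly"), kept Summit-side because the cell-frame
geometry is the route's, not the literature's.

References: route file `Theses/OneCertifiedCube.lean` (item stmt-QuantumFields-16125); Dobrushin–Shlosman,
*Constructive criterion for the uniqueness of Gibbs field* (1985) (finite-size conditions in total variation);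
Georgii, *Gibbs Measures and Phase Transitions* (2011), Def. 2.9 (specification kernels).
-/

set_option autoImplicit false

noncomputable section

namespace Summit.QuantumFields.YangMills.Cruxes.CrossoverCertificate.Birth

open MeasureTheory Filter Topology
open Literature.MathematicalPhysics.QuantumFieldTheory
open Literature.MathematicalPhysics.QuantumLattice

variable {G : Type} [Group G] [TopologicalSpace G] [IsTopologicalGroup G] [CompactSpace G]
  [MeasurableSpace G] [BorelSpace G]

/-- The set of total-variation boundary influences on the central cell at representation `ρ`, inverse coupling
`β`, cell size `b` and shell parameter `n`: all numbers `|∫ f dγ_A(·|η) − ∫ f dγ_A(·|η′)|` over `[b,2b]`-frames `w`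
of `ℤ⁴`, cell unions `A = ⋃_{y ∈ Y} cell_w(y)` with `0 ∈ Y ⊆ [-2n,2n]⁴`, boundary conditions `η, η′` agreeing on the
cube of `(4n+1)⁴` cells, and `[0,1]`-valued measurable cylinder functions `f` of the central cell — VERBATIM the
binders of the crux's finite-size condition (`Theses/OneCertifiedCube.lean`, `CrossoverCertificate`). [folklore] -/
def influenceSet {N : ℕ} (ρ : G →* Matrix (Fin N) (Fin N) ℂ) (β : ℝ) (b n : ℕ) : Set ℝ :=
  {x | ∃ w : Fin 4 → ℤ → ℤ, (∀ i j, w i j + ((b : ℕ) : ℤ) ≤ w i (j + 1) ∧ w i (j + 1) ≤ w i j + 2 * ((b : ℕ) : ℤ)) ∧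
    ∃ Y : Finset (Fin 4 → ℤ), Y ⊆ (Fintype.piFinset fun _ : Fin 4 => Finset.Icc (-(2 * ((n : ℕ) : ℤ))) (2 * ((n : ℕ) : ℤ))) ∧
    (0 : Fin 4 → ℤ) ∈ Y ∧
    ∃ η η' : LGConfig 4 G, (∀ e ∈ (Fintype.piFinset fun _ : Fin 4 => Finset.Icc (-(2 * ((n : ℕ) : ℤ))) (2 * ((n : ℕ) : ℤ))).biUnion (fun y : Fin 4 → ℤ => (Fintype.piFinset fun i : Fin 4 => Finset.Ico (w i (y i)) (w i (y i + 1))) ×ˢ (Finset.univ : Finset (Fin 4))), η e = η' e) ∧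
    ∃ f : LGConfig 4 G → ℝ, IsCylinder f ((fun y : Fin 4 → ℤ => (Fintype.piFinset fun i : Fin 4 => Finset.Ico (w i (y i)) (w i (y i + 1))) ×ˢ (Finset.univ : Finset (Fin 4))) 0) ∧
    Measurable f ∧ (∀ U, 0 ≤ f U ∧ f U ≤ 1) ∧
    x = |(∫ U, f U ∂(ymSpecification ρ β (Y.biUnion (fun y : Fin 4 → ℤ => (Fintype.piFinset fun i : Fin 4 => Finset.Ico (w i (y i)) (w i (y i + 1))) ×ˢ (Finset.univ : Finset (Fin 4)))) η)) - ∫ U, f U ∂(ymSpecification ρ β (Y.biUnion (fun y : Fin 4 → ℤ => (Fintype.piFinset fun i : Fin 4 => Finset.Ico (w i (y i)) (w i (y i + 1))) ×ˢ (Finset.univ : Finset (Fin 4)))) η')|}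

/-- **The TV influence functional** `Θ(ρ, β, b, n) := sup influenceSet` — the worst-case total-variation influence,
on the central cell, of a change of boundary condition outside the cube of `(4n+1)⁴` cells of a `[b,2b]`-frame (the
quantity the route's finite-size condition bounds by `ε`). [folklore] -/
def influence {N : ℕ} (ρ : G →* Matrix (Fin N) (Fin N) ℂ) (β : ℝ) (b n : ℕ) : ℝ :=
  sSup (influenceSet (G := G) ρ β b n)

/-- Each influence is at most `2`: the Wilson kernels are tilted (hence zero-or-probability) measures and `f` takes
values in `[0,1]`, so each of the two integrals has absolute value `≤ 1`. [folklore] -/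
theorem influenceSet_le_two {N : ℕ} (ρ : G →* Matrix (Fin N) (Fin N) ℂ) (β : ℝ) (b n : ℕ) {x : ℝ}
    (hx : x ∈ influenceSet (G := G) ρ β b n) : x ≤ 2 := by
  obtain ⟨w, -, Y, -, -, η, η', -, f, -, -, hf, rfl⟩ := hx
  have key : ∀ ζ : LGConfig 4 G,
      |∫ U, f U ∂(ymSpecification ρ β (Y.biUnion (fun y : Fin 4 → ℤ => (Fintype.piFinset fun i : Fin 4 => Finset.Ico (w i (y i)) (w i (y i + 1))) ×ˢ (Finset.univ : Finset (Fin 4)))) ζ)| ≤ 1 := by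
    intro ζ
    set μ := ymSpecification ρ β (Y.biUnion (fun y : Fin 4 → ℤ => (Fintype.piFinset fun i : Fin 4 => Finset.Ico (w i (y i)) (w i (y i + 1))) ×ˢ (Finset.univ : Finset (Fin 4)))) ζ with hμ
    haveI : IsZeroOrProbabilityMeasure μ := by
      rw [hμ]; unfold ymSpecification; infer_instance
    have h1 : ‖∫ U, f U ∂μ‖ ≤ 1 * μ.real Set.univ :=
      norm_integral_le_of_norm_le_const (Filter.Eventually.of_forall fun U => by
        rw [Real.norm_eq_abs, abs_le]; exact ⟨by linarith [(hf U).1], (hf U).2⟩)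
    have h2 : μ.real Set.univ ≤ 1 := by
      rw [measureReal_def]
      exact ENNReal.toReal_le_of_le_ofReal zero_le_one (by simpa using prob_le_one)
    rw [← Real.norm_eq_abs]
    linarith
  have hA := key η
  have hB := key η'
  rw [abs_le] at hA hB ⊢
  constructor <;> linarith [hA.1, hA.2, hB.1, hB.2]

/-- The influence set is bounded above (by `2`). [folklore] -/
theorem bddAbove_influenceSet {N : ℕ} (ρ : G →* Matrix (Fin N) (Fin N) ℂ) (β : ℝ) (b n : ℕ) :
    BddAbove (influenceSet (G := G) ρ β b n) :=
  ⟨2, fun _ hx => influenceSet_le_two ρ β b n hx⟩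

/-- `0` is an influence: the frame `w i j = b·j`, `Y = {0}`, `η = η′ = 1` and `f = 0` realise it. [folklore] -/
theorem zero_mem_influenceSet {N : ℕ} (ρ : G →* Matrix (Fin N) (Fin N) ℂ) (β : ℝ) (b n : ℕ) :
    (0 : ℝ) ∈ influenceSet (G := G) ρ β b n := by
  refine ⟨fun i j => (b : ℤ) * j, ?_, {0}, ?_, Finset.mem_singleton_self _, 1, 1, fun _ _ => rfl,
    fun _ => 0, ?_, measurable_const, fun _ => ⟨le_rfl, zero_le_one⟩, by simp⟩
  · intro i j; constructor <;> push_cast <;> nlinarith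
  · intro y hy
    rw [Finset.mem_singleton] at hy; subst hy
    simp
  · intro U V _; rfl

/-- The influence set is nonempty. [folklore] -/
theorem influenceSet_nonempty {N : ℕ} (ρ : G →* Matrix (Fin N) (Fin N) ℂ) (β : ℝ) (b n : ℕ) :
    (influenceSet (G := G) ρ β b n).Nonempty :=
  ⟨0, zero_mem_influenceSet ρ β b n⟩

/-- `0 ≤ Θ(ρ, β, b, n)`. [folklore] -/
theorem influence_nonneg {N : ℕ} (ρ : G →* Matrix (Fin N) (Fin N) ℂ) (β : ℝ) (b n : ℕ) :
    0 ≤ influence (G := G) ρ β b n :=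
  le_csSup (bddAbove_influenceSet ρ β b n) (zero_mem_influenceSet ρ β b n)

/-- `Θ(ρ, β, b, n) ≤ 2`. [folklore] -/
theorem influence_le_two {N : ℕ} (ρ : G →* Matrix (Fin N) (Fin N) ℂ) (β : ℝ) (b n : ℕ) :
    influence (G := G) ρ β b n ≤ 2 :=
  csSup_le (influenceSet_nonempty ρ β b n) fun _ hx => influenceSet_le_two ρ β b n hx

/-- Every single influence is bounded by the functional (`le_csSup`). [folklore] -/
theorem le_influence {N : ℕ} (ρ : G →* Matrix (Fin N) (Fin N) ℂ) (β : ℝ) (b n : ℕ) {x : ℝ}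
    (hx : x ∈ influenceSet (G := G) ρ β b n) : x ≤ influence (G := G) ρ β b n :=
  le_csSup (bddAbove_influenceSet ρ β b n) hx

/-- **Bridge.** The crux's TV finite-size condition at `(ρ, β, b, n, ε)` — VERBATIM the condition inside its `∀ᶠ k`
(with `r.ρ ↦ ρ`, `sch.β k ↦ β`, `⌈ℓ/a_k⌉₊ ↦ b`) — holds iff `Θ(ρ, β, b, n) ≤ ε` (`le_csSup` / `csSup_le`, the set
being nonempty and bounded). [folklore] -/
theorem finiteSize_iff_influence_le {N : ℕ} (ρ : G →* Matrix (Fin N) (Fin N) ℂ) (β : ℝ) (b n : ℕ) (ε : ℝ) :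
    (∀ w : Fin 4 → ℤ → ℤ, (∀ i j, w i j + ((b : ℕ) : ℤ) ≤ w i (j + 1) ∧ w i (j + 1) ≤ w i j + 2 * ((b : ℕ) : ℤ)) → ∀ Y : Finset (Fin 4 → ℤ), Y ⊆ (Fintype.piFinset fun _ : Fin 4 => Finset.Icc (-(2 * ((n : ℕ) : ℤ))) (2 * ((n : ℕ) : ℤ))) → (0 : Fin 4 → ℤ) ∈ Y → ∀ η η' : LGConfig 4 G, (∀ e ∈ (Fintype.piFinset fun _ : Fin 4 => Finset.Icc (-(2 * ((n : ℕ) : ℤ))) (2 * ((n : ℕ) : ℤ))).biUnion (fun y : Fin 4 → ℤ => (Fintype.piFinset fun i : Fin 4 => Finset.Ico (w i (y i)) (w i (y i + 1))) ×ˢ (Finset.univ : Finset (Fin 4))), η e = η' e) → ∀ f : LGConfig 4 G → ℝ, IsCylinder f ((fun y : Fin 4 → ℤ => (Fintype.piFinset fun i : Fin 4 => Finset.Ico (w i (y i)) (w i (y i + 1))) ×ˢ (Finset.univ : Finset (Fin 4))) 0) → Measurable f → (∀ U, 0 ≤ f U ∧ f U ≤ 1) → |(∫ U, f U ∂(ymSpecification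 ρ β (Y.biUnion (fun y : Fin 4 → ℤ => (Fintype.piFinset fun i : Fin 4 => Finset.Ico (w i (y i)) (w i (y i + 1))) ×ˢ (Finset.univ : Finset (Fin 4)))) η)) - ∫ U, f U ∂(ymSpecification ρ β (Y.biUnion (fun y : Fin 4 → ℤ => (Fintype.piFinset fun i : Fin 4 => Finset.Ico (w i (y i)) (w i (y i + 1))) ×ˢ (Finset.univ : Finset (Fin 4)))) η')| ≤ ε) ↔
      influence (G := G) ρ β b n ≤ ε := by
  constructor
  · intro h
    refine csSup_le (influenceSet_nonempty ρ β b n) ?_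
    rintro x ⟨w, hw, Y, hY, h0, η, η', hagree, f, hcyl, hmeas, hf01, rfl⟩
    exact h w hw Y hY h0 η η' hagree f hcyl hmeas hf01
  · intro h w hw Y hY h0 η η' hagree f hcyl hmeas hf01
    exact (le_influence ρ β b n ⟨w, hw, Y, hY, h0, η, η', hagree, f, hcyl, hmeas, hf01, rfl⟩).trans h

/-- **The crux over this vocabulary** (`Iff` by rewriting the finite-size condition under the binders with
`finiteSize_iff_influence_le`): `CrossoverCertificate` says that along every admissible weak-coupling scheme with a
non-trivial non-Gaussian Yang–Mills limit there are ONE physical length `ℓ > 0`, `n ≥ 1` and `ε ≥ 0` with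
`ε · M(n) < 1`, `M(n) = (4n+3)⁴ − (4n+1)⁴`, such that `Θ(r.ρ, β_k, ⌈ℓ/a_k⌉₊, n) ≤ ε` for all large `k`. [folklore] -/
theorem crossoverCertificate_iff :
    Summit.QuantumFields.YangMills.Theses.OneCertifiedCube.CrossoverCertificate ↔
      ∀ (G : Type) [Group G] [TopologicalSpace G] [IsTopologicalGroup G] [CompactSpace G] [MeasurableSpace G]
        [BorelSpace G], IsCompactSimpleLieGroup G → ∀ (r : LatticeRep G) (sch : SpeciesScheme (YMSpecies G))
        (T : OSData (YMSpecies G) 4), sch.HasWeakCouplingLimit → IsYangMillsFor r sch T →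
        T.IsNontrivial r.curvature → T.IsNonGaussian r.curvature →
        ∃ ℓ : ℝ, 0 < ℓ ∧ ∃ (n : ℕ) (ε : ℝ), 1 ≤ n ∧ 0 ≤ ε ∧
          ε * ((((4 * n + 3) ^ 4 - (4 * n + 1) ^ 4 : ℕ)) : ℝ) < 1 ∧
          ∀ᶠ k : ℕ in atTop, influence r.ρ (sch.β k) ⌈ℓ / sch.a k⌉₊ n ≤ ε := by
  unfold Summit.QuantumFields.YangMills.Theses.OneCertifiedCube.CrossoverCertificate
  simp only [finiteSize_iff_influence_le]

end Summit.QuantumFields.YangMills.Cruxes.CrossoverCertificate.Birth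

end
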